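import Summits.HubbardSuperconductivity.HubbardSuperconductivity.Theorems.CwThesis.Negative.StructureAndWindow
import Summits.HubbardSuperconductivity.HubbardSuperconductivity.Theorems.CwThesis.Negative.FreeEndpointPairBound
import Literature.MathematicalPhysics.QuantumLattice.ApproximateEigenvectorLemmas
import Literature.MathematicalPhysics.QuantumLattice.DWaveSourceProofs
import HarnessLib

/-!
# Route `ChiralWindow`, crux `CwThesis` (stmt-HubbardSuperconductivity-10438): the GROUND-RING normal form

Line `SketchIdeator2` (ring line). The engine `stub_ringTraces` of the line bounds the THERMAL second moment of the
pair intensity `Q = Δ_d†Δ_d` about a centre `cL⁴` (times the participation number) at `β = κL`; through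
`stub_participationChebyshev` this forces the same second-moment bound on every sector GROUND STATE, and then the
floor. This file records that the `T = 0` shadow of the engine is not stronger than the crux: the "ground-ring" form

  GR : ∃U₀>0 ∀U∈(0,U₀) ∃δ∈[3/10,12/25] ∃c>0 ∃θ∈[0,1) ∀ᶠk ∀ normalised sector ground states ψ at side L = 2k+2,
       Re⟨ψ, (Q - cL⁴)² ψ⟩ ≤ (θ c L⁴)²

is EQUIVALENT to `CwThesis` (`cwThesis_iff_groundRing`). So `stub_ringTraces` exceeds the crux by exactly one thing —
second-moment concentration of `Q` in the log-cold canonical Gibbs state (with its participation number) rather than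
in the ground states — just as line `SketchIdeator3`'s engine exceeds it by stability of the floor under `O(1)`-energy
excitations (`gibbsPenaltyFloor_iff_energyWindowFloor`).

* `floor_of_ringVector` — abstract: `Re⟨ψ,(Q-C)²ψ⟩ ≤ r²`, `r ≥ 0`, `‖ψ‖ = 1` ⇒ `C - r ≤ Re⟨ψ,Qψ⟩` (Cauchy–Schwarz);
* `ring_of_floorVector` — abstract: for `Q = PᴴP` with `‖P‖ ≤ p`, a floor `a ≤ Re⟨ψ,Qψ⟩` and a centre `C`
  with `p² ≤ 2C` give `Re⟨ψ,(Q-C)²ψ⟩ ≤ C² - (2C - p²)·a` (`Re⟨ψ,Q²ψ⟩ = ‖PᴴPψ‖² ≤ ‖P‖²·Re⟨ψ,Qψ⟩`);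
* `cwThesis_iff_groundRing` — the equivalence, through the disprover's floor normal form `cwThesis_iff_floor`
  (Disproof §5) and `‖Δ_d‖ ≤ c_d L²` (`norm_pairField_le`).

Folklore bookkeeping; no definition is introduced. Koma–Tasaki, J. Stat. Phys. 76 (1994) §2; Scalapino, Phys. Rep.
250 (1995) §2 eq. (2.4).
-/

noncomputable section

namespace Summit.HubbardSuperconductivity.HubbardSuperconductivity.Theorems.CwThesis

-- `Summit.HubbardSuperconductivity.HubbardSuperconductivity.…` repeats the summit name by design (D-0017 layout)
set_option linter.dupNamespace false

open Matrix Filter Literature.MathematicalPhysics.QuantumLattice Literature.Probability.LatticeModels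
open Summit.HubbardSuperconductivity.HubbardSuperconductivity.Theses
open Summit.HubbardSuperconductivity.CwThesis.Negative (cwThesis_iff_floor star_dotProduct_conjTranspose_mulVec')
open scoped ComplexOrder Matrix.Norms.L2Operator

/-! ### Two abstract vector lemmas (`⟨x, Aᴴy⟩ = ⟨Ax, y⟩` is the tree's `star_dotProduct_conjTranspose_mulVec'`) -/

/-- **Second moment about a centre ⇒ floor.** For Hermitian `Q`, a real centre `C`, `r ≥ 0` and a unit vector
`ψ` with `Re⟨ψ, (Q - C)·(Q - C) ψ⟩ ≤ r²`: `C - r ≤ Re⟨ψ, Qψ⟩` (`|⟨ψ,(Q-C)ψ⟩| ≤ ‖(Q-C)ψ‖ ≤ r` by Cauchy–Schwarz,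
and `⟨ψ,(Q-C)ψ⟩ = ⟨ψ,Qψ⟩ - C`). [folklore] -/
theorem floor_of_ringVector {m : Type*} [Fintype m] [DecidableEq m] (Q : Matrix m m ℂ) (hQ : Q.IsHermitian)
    {C r : ℝ} (hr : 0 ≤ r) (ψ : m → ℂ) (hψ : star ψ ⬝ᵥ ψ = 1)
    (hring : (star ψ ⬝ᵥ ((Q - (C : ℂ) • 1) * (Q - (C : ℂ) • 1)) *ᵥ ψ).re ≤ r ^ 2) :
    C - r ≤ (star ψ ⬝ᵥ Q *ᵥ ψ).re := by
  set D : Matrix m m ℂ := Q - (C : ℂ) • 1 with hD_def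
  have hD : D.IsHermitian := by
    rw [hD_def]
    refine hQ.sub ?_
    exact IsHermitian.smul isHermitian_one (Complex.conj_ofReal C)
  -- `‖Dψ‖² = Re⟨ψ, D·D ψ⟩ ≤ r²`
  have hsq : eucNorm (D *ᵥ ψ) ^ 2 ≤ r ^ 2 := by
    rw [eucNorm_sq, ← star_dotProduct_conjTranspose_mulVec', hD.eq, mulVec_mulVec]
    exact hring
  have hnorm : eucNorm (D *ᵥ ψ) ≤ r := by
    nlinarith [eucNorm_nonneg (D *ᵥ ψ), sq_nonneg (eucNorm (D *ᵥ ψ) - r)]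
  -- `|⟨ψ, Dψ⟩| ≤ ‖ψ‖ ‖Dψ‖ = ‖Dψ‖ ≤ r`
  have hcs : ‖star ψ ⬝ᵥ (D *ᵥ ψ)‖ ≤ r := by
    calc ‖star ψ ⬝ᵥ (D *ᵥ ψ)‖ ≤ eucNorm ψ * eucNorm (D *ᵥ ψ) := norm_star_dotProduct_le _ _
      _ = eucNorm (D *ᵥ ψ) := by rw [eucNorm_eq_one hψ, one_mul]
      _ ≤ r := hnorm
  -- `⟨ψ, Dψ⟩ = ⟨ψ, Qψ⟩ - C`
  have hexp : star ψ ⬝ᵥ (D *ᵥ ψ) = star ψ ⬝ᵥ (Q *ᵥ ψ) - (C : ℂ) := by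
    rw [hD_def, sub_mulVec, dotProduct_sub, smul_mulVec, one_mulVec, dotProduct_smul, hψ, smul_eq_mul,
      mul_one]
  have hre : -(star ψ ⬝ᵥ (D *ᵥ ψ)).re ≤ r :=
    (neg_le_abs _).trans ((Complex.abs_re_le_norm _).trans hcs)
  rw [hexp, Complex.sub_re, Complex.ofReal_re] at hre
  linarith

/-- **Floor ⇒ second moment about a large centre, for a Gram observable.** For `Q = PᴴP` with `‖P‖ ≤ p`, a unit
vector `ψ` with the floor `a ≤ Re⟨ψ, Qψ⟩` and a centre `C` with `p² ≤ 2C`: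
`Re⟨ψ, (Q - C)·(Q - C) ψ⟩ ≤ C² - (2C - p²)·a`. Indeed `Re⟨ψ,Q²ψ⟩ = ‖Pᴴ(Pψ)‖² ≤ ‖P‖² ‖Pψ‖² = ‖P‖² Re⟨ψ,Qψ⟩`, so
`Re⟨ψ,(Q-C)²ψ⟩ = Re⟨ψ,Q²ψ⟩ - 2C Re⟨ψ,Qψ⟩ + C² ≤ C² - (2C - p²) Re⟨ψ,Qψ⟩ ≤ C² - (2C - p²) a`. [folklore] -/
theorem ring_of_floorVector {m : Type*} [Fintype m] [DecidableEq m] (P : Matrix m m ℂ) {p a C : ℝ}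
    (hp : ‖P‖ ≤ p) (hC : p ^ 2 ≤ 2 * C) (ψ : m → ℂ) (hψ : star ψ ⬝ᵥ ψ = 1)
    (hfloor : a ≤ (star ψ ⬝ᵥ (Pᴴ * P) *ᵥ ψ).re) :
    (star ψ ⬝ᵥ ((Pᴴ * P - (C : ℂ) • 1) * (Pᴴ * P - (C : ℂ) • 1)) *ᵥ ψ).re ≤ C ^ 2 - (2 * C - p ^ 2) * a := by
  set Q : Matrix m m ℂ := Pᴴ * P with hQ_def
  have hQh : Q.IsHermitian := isHermitian_conjTranspose_mul_self _
  have hp0 : 0 ≤ p := (norm_nonneg _).trans hp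
  -- `q := Re⟨ψ, Qψ⟩ = ‖Pψ‖²`
  have hq : (star ψ ⬝ᵥ Q *ᵥ ψ).re = eucNorm (P *ᵥ ψ) ^ 2 := by
    rw [eucNorm_sq, ← star_dotProduct_conjTranspose_mulVec', mulVec_mulVec]
  -- `Re⟨ψ, Q·Q ψ⟩ = ‖Qψ‖² ≤ ‖P‖² ‖Pψ‖² ≤ p² q`
  have hQQ : (star ψ ⬝ᵥ (Q * Q) *ᵥ ψ).re ≤ p ^ 2 * (star ψ ⬝ᵥ Q *ᵥ ψ).re := by
    have h1 : (star ψ ⬝ᵥ (Q * Q) *ᵥ ψ).re = eucNorm (Q *ᵥ ψ) ^ 2 := by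
      rw [eucNorm_sq, ← star_dotProduct_conjTranspose_mulVec', hQh.eq, mulVec_mulVec]
    have h2 : eucNorm (Q *ᵥ ψ) ≤ p * eucNorm (P *ᵥ ψ) := by
      rw [hQ_def, ← mulVec_mulVec]
      calc eucNorm (Pᴴ *ᵥ (P *ᵥ ψ)) ≤ ‖Pᴴ‖ * eucNorm (P *ᵥ ψ) := eucNorm_mulVec_le _ _
        _ ≤ p * eucNorm (P *ᵥ ψ) := by
            rw [Matrix.l2_opNorm_conjTranspose]
            exact mul_le_mul_of_nonneg_right hp (eucNorm_nonneg _)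
    rw [h1, hq]
    have h3 : 0 ≤ eucNorm (Q *ᵥ ψ) := eucNorm_nonneg _
    calc eucNorm (Q *ᵥ ψ) ^ 2 ≤ (p * eucNorm (P *ᵥ ψ)) ^ 2 := pow_le_pow_left₀ h3 h2 2
      _ = p ^ 2 * eucNorm (P *ᵥ ψ) ^ 2 := by ring
  -- expand `(Q - C)² = Q·Q - 2C·Q + C²` on `ψ`
  have hmat : (Q - (C : ℂ) • 1) * (Q - (C : ℂ) • 1) =
      Q * Q - (2 * (C : ℂ)) • Q + ((C : ℂ) ^ 2) • (1 : Matrix m m ℂ) := by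
    simp only [sub_mul, mul_sub, Matrix.mul_smul, Matrix.smul_mul, Matrix.mul_one, Matrix.one_mul, smul_smul]
    module
  have hexpand : star ψ ⬝ᵥ ((Q - (C : ℂ) • 1) * (Q - (C : ℂ) • 1)) *ᵥ ψ =
      star ψ ⬝ᵥ (Q * Q) *ᵥ ψ - ((2 * C : ℝ) : ℂ) * (star ψ ⬝ᵥ Q *ᵥ ψ) + ((C ^ 2 : ℝ) : ℂ) := by
    rw [hmat, add_mulVec, sub_mulVec, dotProduct_add, dotProduct_sub, smul_mulVec, dotProduct_smul,
      smul_mulVec, one_mulVec, dotProduct_smul, hψ, smul_eq_mul, smul_eq_mul, mul_one]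
    push_cast
    ring
  have hre : (star ψ ⬝ᵥ ((Q - (C : ℂ) • 1) * (Q - (C : ℂ) • 1)) *ᵥ ψ).re =
      (star ψ ⬝ᵥ (Q * Q) *ᵥ ψ).re - 2 * C * (star ψ ⬝ᵥ Q *ᵥ ψ).re + C ^ 2 := by
    rw [hexpand, Complex.add_re, Complex.sub_re, Complex.re_ofReal_mul, Complex.ofReal_re]
  rw [hre]
  have hqa : a ≤ (star ψ ⬝ᵥ Q *ᵥ ψ).re := hfloor
  have h2C : 0 ≤ 2 * C - p ^ 2 := by linarith
  nlinarith [hQQ, mul_le_mul_of_nonneg_left hqa h2C]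

/-! ### The ground-ring normal form of the crux -/

/-- **`CwThesis` ⇔ the ground ring.** `CwThesis` holds iff for all small `U > 0` there are a doping `δ_U` in the
window, a centre `c(U) > 0` and a relative width `θ(U) ∈ [0,1)` such that, at every large even side `L = 2k+2`, EVERY
normalised ground state `ψ` of `hubbardTorus 2 L 1 U` in the sector `(2⌊(1-δ_U)L²/2⌋, 0)` has second moment
`Re⟨ψ, (Q - cL⁴)·(Q - cL⁴) ψ⟩ ≤ (θ c L⁴)²`, `Q = Δ_d†Δ_d = (pairField dWaveFormFactor L)ᴴ pairField …`.
(`←`: `floor_of_ringVector` gives the floor `(1-θ)c·L⁴`, then `cwThesis_iff_floor`; `→`: `cwThesis_iff_floor` gives a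
floor `a L⁴`, and `ring_of_floorVector` with `‖Δ_d‖ ≤ c_d L²` (`norm_pairField_le`), `a₀ = min a (c_d²+1)`, centre
`c = (c_d²+1)/2 + a₀/4`, `θ = √(1 - a₀²/(2c²))`.) The `T = 0` shadow of the ring line's engine is therefore exactly
the crux. [folklore] -/
theorem cwThesis_iff_groundRing :
    ChiralWindow.CwThesis ↔ ∃ U₀ : ℝ, 0 < U₀ ∧ ∀ U ∈ Set.Ioo (0:ℝ) U₀, ∃ δ ∈ Set.Icc (3/10 : ℝ) (12/25),
      ∃ c θ : ℝ, 0 < c ∧ 0 ≤ θ ∧ θ < 1 ∧ ∀ᶠ k : ℕ in atTop,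
        ∀ ψ : Fock (Orb (FermionTorus 2 (2 * k + 1 + 1))),
          IsGroundStateInSector (hubbardTorus 2 (2 * k + 1 + 1) 1 U)
              (2 * ⌊(1 - δ) * (((2 * k + 1 + 1 : ℕ) : ℝ)) ^ 2 / 2⌋₊) 0 ψ →
            star ψ ⬝ᵥ ψ = 1 →
              (star ψ ⬝ᵥ
                  (((pairField dWaveFormFactor (2 * k + 1 + 1))ᴴ * pairField dWaveFormFactor (2 * k + 1 + 1) -
                      ((c * ((2 * k + 1 + 1 : ℕ) : ℝ) ^ 4 : ℝ) : ℂ) • 1) *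
                    ((pairField dWaveFormFactor (2 * k + 1 + 1))ᴴ * pairField dWaveFormFactor (2 * k + 1 + 1) -
                      ((c * ((2 * k + 1 + 1 : ℕ) : ℝ) ^ 4 : ℝ) : ℂ) • 1)) *ᵥ ψ).re ≤
                (θ * c * ((2 * k + 1 + 1 : ℕ) : ℝ) ^ 4) ^ 2 := by
  rw [cwThesis_iff_floor]
  refine exists_congr fun U₀ => and_congr_right fun _ => forall₂_congr fun U _ =>
    exists_congr fun δ => and_congr_right fun _ => ?_
  constructor
  · -- floor ⇒ ring
    rintro ⟨a, ha, hev⟩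
    -- the `d`-wave norm constant `c_d` of `norm_pairField_le` and the constants of the ring
    set cd : ℝ := 2 * ∑ e ∈ insert (0 : Site 2) unitSteps, |dWaveFormFactor e / Real.sqrt 2| with hcd_def
    set B : ℝ := cd ^ 2 + 1 with hB_def
    have hB : 0 < B := by positivity
    set a₀ : ℝ := min a B with ha₀_def
    have ha₀ : 0 < a₀ := lt_min ha hB
    have ha₀a : a₀ ≤ a := min_le_left _ _
    have ha₀B : a₀ ≤ B := min_le_right _ _
    set c : ℝ := B / 2 + a₀ / 4 with hc_def
    have hc : 0 < c := by positivity
    set t : ℝ := 1 - a₀ ^ 2 / (2 * c ^ 2) with ht_def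
    have hc2 : 0 < 2 * c ^ 2 := by positivity
    have ht0 : 0 ≤ t := by
      rw [ht_def, sub_nonneg, div_le_one hc2]
      nlinarith
    have ht1 : t < 1 := by
      rw [ht_def, sub_lt_self_iff]
      positivity
    have hθ1 : Real.sqrt t < 1 := (Real.sqrt_lt_sqrt ht0 ht1).trans_eq Real.sqrt_one
    refine ⟨c, Real.sqrt t, hc, Real.sqrt_nonneg _, hθ1, ?_⟩
    filter_upwards [hev] with k hk ψ hψ hψ1
    haveI : NeZero (2 * k + 1 + 1) := ⟨by omega⟩
    have hL4 : (0 : ℝ) < ((2 * k + 1 + 1 : ℕ) : ℝ) ^ 4 := by positivity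
    have hfl : a₀ * ((2 * k + 1 + 1 : ℕ) : ℝ) ^ 4 ≤
        (star ψ ⬝ᵥ ((pairField dWaveFormFactor (2 * k + 1 + 1))ᴴ *
          pairField dWaveFormFactor (2 * k + 1 + 1)) *ᵥ ψ).re := by
      have h := hk ψ hψ hψ1
      simp only [expect] at h
      exact (mul_le_mul_of_nonneg_right ha₀a hL4.le).trans h
    have hpn : ‖pairField dWaveFormFactor (2 * k + 1 + 1)‖ ≤ cd * ((2 * k + 1 + 1 : ℕ) : ℝ) ^ 2 :=
      norm_pairField_le dWaveFormFactor (2 * k + 1 + 1)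
    have hCond : (cd * ((2 * k + 1 + 1 : ℕ) : ℝ) ^ 2) ^ 2 ≤ 2 * (c * ((2 * k + 1 + 1 : ℕ) : ℝ) ^ 4) := by
      have : cd ^ 2 ≤ 2 * c := by rw [hc_def]; linarith
      nlinarith
    have hring := ring_of_floorVector (pairField dWaveFormFactor (2 * k + 1 + 1)) hpn hCond ψ hψ1 hfl
    refine hring.trans ?_
    -- `C² - (2C - p²)·a₀L⁴ ≤ (θ c L⁴)²` with `θ² = t = 1 - a₀²/(2c²)`
    have hθ2 : Real.sqrt t ^ 2 = t := Real.sq_sqrt ht0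
    have h1 : (Real.sqrt t * c * ((2 * k + 1 + 1 : ℕ) : ℝ) ^ 4) ^ 2 =
        t * c ^ 2 * (((2 * k + 1 + 1 : ℕ) : ℝ) ^ 4) ^ 2 := by
      rw [mul_pow, mul_pow, hθ2]
    have h2 : t * c ^ 2 = c ^ 2 - a₀ ^ 2 / 2 := by
      rw [ht_def]
      field_simp
    rw [h1, h2]
    have h3 : 2 * c - cd ^ 2 = 1 + a₀ / 2 := by rw [hc_def, hB_def]; ring
    have h4 : (c * ((2 * k + 1 + 1 : ℕ) : ℝ) ^ 4) ^ 2 -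
        (2 * (c * ((2 * k + 1 + 1 : ℕ) : ℝ) ^ 4) - (cd * ((2 * k + 1 + 1 : ℕ) : ℝ) ^ 2) ^ 2) *
          (a₀ * ((2 * k + 1 + 1 : ℕ) : ℝ) ^ 4) =
        (c ^ 2 - (2 * c - cd ^ 2) * a₀) * (((2 * k + 1 + 1 : ℕ) : ℝ) ^ 4) ^ 2 := by ring
    rw [h4, h3]
    have h5 : c ^ 2 - (1 + a₀ / 2) * a₀ ≤ c ^ 2 - a₀ ^ 2 / 2 := by nlinarith
    exact mul_le_mul_of_nonneg_right h5 (by positivity)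
  · -- ring ⇒ floor
    rintro ⟨c, θ, hc, hθ, hθ1, hev⟩
    refine ⟨(1 - θ) * c, mul_pos (by linarith) hc, ?_⟩
    filter_upwards [hev] with k hk ψ hψ hψ1
    haveI : NeZero (2 * k + 1 + 1) := ⟨by omega⟩
    have hQ : ((pairField dWaveFormFactor (2 * k + 1 + 1))ᴴ *
        pairField dWaveFormFactor (2 * k + 1 + 1)).IsHermitian :=
      isHermitian_conjTranspose_mul_self _
    have hr : 0 ≤ θ * c * ((2 * k + 1 + 1 : ℕ) : ℝ) ^ 4 := by positivity
    have h := floor_of_ringVector _ hQ hr ψ hψ1 (hk ψ hψ hψ1)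
    simp only [expect]
    linarith

end Summit.HubbardSuperconductivity.HubbardSuperconductivity.Theorems.CwThesis

end
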